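import Mathlib
import Summits.Langlands.Langlands.Theorems.TrigonalHeartLimitHeartTwistedTensorPrelude
import Literature.GroupTheory.SpecificGroups.AlternatingSixPSL2Nine
import HarnessLib

/-!
# The heart of `𝔽₃[six points]` and the twisted tensor square of `SL₂(𝔽₉)`, II: the labelled isomorphism

Second prelude to `Summits/Langlands/Langlands/Theorems/TrigonalHeartLimitHeartTwistedTensor.lean`
(route item `Summit.Langlands.Langlands.Theses.TrigonalHeartLimit.HeartTwistedTensor`,
`stmt-Langlands-12741`). Over Wilson's computable model `𝔽₃[i]`
(`Literature.GroupTheory.SpecificGroups.AltSixPSL`, which proves `A₆ ≅ PSL₂(𝔽₉)` through the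
labelling `e` of the ten bisections of six letters by `ℙ¹(𝔽₉)`):

* `phi9 : SL₂(𝔽₃[i]) →* S₆` is `A₆ ↪ S₆ ∘ Θ⁻¹ ∘ (SL₂ → PSL₂)` for the isomorphism
  `Θ : A₆ ≃* PSL₂(𝔽₉)` of part II of that file, rebuilt here as a DEFINITION so that it comes with
  the specification `phi9_eq_of`: `phi9 g = σ` as soon as `σ ∈ A₆` and `e (σ • b) = g • e b` for the
  ten bisections `b` — a `decide` check; this pins `phi9` on the generators
  `u = (1 1; 0 1) ↦ (0 1 2)`, `v = (1 i; 0 1) ↦ (3 4 5)`, `w = (0 1; -1 0) ↦ (0 3)(1 2)`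
  (Wilson: `z ↦ z + 1` is `(0 1 2)`, `z ↦ z + i` is `(3 4 5)`); `phi9` has image `A₆` (`phi9_range`).
* the intertwiner `P9` (found offline by solving the linear system on `u, v, w`; `det P9 = 2i ≠ 0`)
  and the three generator certificates `Heart(φ₉ x) · P9 = P9 · tw x`, `x = u, v, w`, by `decide`.

## References

* R. A. Wilson, *The Finite Simple Groups*, GTM 251, Springer 2009, §3.3.5. [Wilson2009]
* route file `Summits/Langlands/Langlands/Theses/TrigonalHeartLimit.lean`, item `HeartTwistedTensor`.
-/

set_option linter.dupNamespace false

open scoped LinearAlgebra.Projectivization MatrixGroups Pointwise Kronecker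

namespace Summit.Langlands.Langlands.Theorems.TrigonalHeartLimitHeartTwistedTensor

open Literature.GroupTheory.SpecificGroups Literature.GroupTheory.SpecificGroups.AltSixPSL

/-! ### An explicit `A₆ ≃* PSL₂(𝔽₉)` compatible with Wilson's labelling -/

/-- Wilson's labelling as a bijection `B ≃ ℙ¹(𝔽₉)`. [cite: Wilson2009, §3.3.5] -/
noncomputable def eqv : B ≃ P := Equiv.ofBijective e e_bijective

/-- `eqv b = e b`. [folklore] -/
theorem eqv_apply (b : B) : eqv b = e b := rfl

/-- `A₆` acting on `ℙ¹(𝔽₉)` through the labelling. [cite: Wilson2009, §3.3.5] -/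
noncomputable def ρ : alternatingGroup (Fin 6) →* Equiv.Perm P :=
  eqv.permCongrHom.toMonoidHom.comp
    ((MulAction.toPermHom (Equiv.Perm (Fin 6)) B).comp (alternatingGroup (Fin 6)).subtype)

/-- `ρ σ (e b) = e (σ • b)`. [folklore] -/
theorem ρ_apply (σ : alternatingGroup (Fin 6)) (b : B) :
    ρ σ (eqv b) = e ((σ : Equiv.Perm (Fin 6)) • b) := by
  simp [ρ, eqv]

/-- `ρ` is injective (`A₆` acts faithfully on bisections). [folklore] -/
theorem ρ_injective : Function.Injective ρ :=
  eqv.permCongrHom.injective.comp toPermHom_comp_subtype_injective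

/-- `PSL₂(𝔽₉) →* Perm ℙ¹(𝔽₉)` (Mathlib). [folklore] -/
noncomputable def ψP : PSL(2, F9) →* Equiv.Perm P :=
  Projectivization.PSLAction.toPermHom (K := F9) (ι := Fin 2)

/-- Every `ρ σ` is a projective linear transformation. [cite: Wilson2009, §3.3.5] -/
theorem ρ_mem_range (σ : alternatingGroup (Fin 6)) : ρ σ ∈ ψP.range := by
  obtain ⟨g, hg⟩ := exists_sl_of_mem_alternatingGroup σ.2
  refine ⟨(g : PSL(2, F9)), Equiv.ext fun p => ?_⟩
  obtain ⟨b, rfl⟩ := eqv.surjective p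
  rw [ρ_apply, eqv_apply, hg b]
  rfl

/-- `PSL₂(𝔽₉) ≃* (its image in Perm ℙ¹(𝔽₉))`. [folklore] -/
noncomputable def Ψ : PSL(2, F9) ≃* ψP.range :=
  MonoidHom.ofInjective Matrix.ProjectiveSpecialLinearGroup.toPermHom_injective

/-- The monomorphism `A₆ →* PSL₂(𝔽₉)`. [cite: Wilson2009, §3.3.5] -/
noncomputable def θ : alternatingGroup (Fin 6) →* PSL(2, F9) :=
  Ψ.symm.toMonoidHom.comp (ρ.codRestrict _ ρ_mem_range)

/-- `θ σ` acts on `ℙ¹(𝔽₉)` as `ρ σ`. [folklore] -/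
theorem ψP_θ (σ : alternatingGroup (Fin 6)) : ψP (θ σ) = ρ σ := by
  have h1 : ((Ψ (θ σ) : ψP.range) : Equiv.Perm P) = ψP (θ σ) := rfl
  have h2 : Ψ (θ σ) = ρ.codRestrict _ ρ_mem_range σ := by
    show Ψ (Ψ.symm _) = _
    exact Ψ.apply_symm_apply _
  rw [← h1, h2]
  rfl

/-- `θ` is injective. [folklore] -/
theorem θ_injective : Function.Injective θ := fun x y h => by
  have h1 := congrArg ψP h
  rw [ψP_θ, ψP_θ] at h1
  exact ρ_injective h1

/-- `θ` is bijective (`|A₆| = 360 ≥ |PSL₂(𝔽₉)|`). [cite: Wilson2009, §3.3.5] -/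
theorem θ_bijective : Function.Bijective θ :=
  θ_injective.bijective_of_nat_card_le (natCard_alternatingGroup ▸ natCard_PSL_le)

/-- **`Θ : A₆ ≃* PSL₂(𝔽₉)`**, compatible with Wilson's labelling. [cite: Wilson2009, §3.3.5] -/
noncomputable def Θ : alternatingGroup (Fin 6) ≃* PSL(2, F9) := MulEquiv.ofBijective θ θ_bijective

/-- `φ₉ : SL₂(𝔽₉) → PSL₂(𝔽₉) ≅ A₆ ≤ S₆`. [this route] -/
noncomputable def phi9 : SL(2, F9) →* Equiv.Perm (Fin 6) :=
  (alternatingGroup (Fin 6)).subtype.comp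
    (Θ.symm.toMonoidHom.comp (QuotientGroup.mk' (Subgroup.center SL(2, F9))))

/-- `φ₉` has image `A₆`. [this route] -/
theorem phi9_range : phi9.range = alternatingGroup (Fin 6) := by
  have hs : Function.Surjective
      (Θ.symm.toMonoidHom.comp (QuotientGroup.mk' (Subgroup.center SL(2, F9)))) :=
    Θ.symm.surjective.comp (QuotientGroup.mk'_surjective _)
  rw [phi9, MonoidHom.range_comp, MonoidHom.range_eq_top.mpr hs, ← MonoidHom.range_eq_map,
    Subgroup.range_subtype]

/-- **Specification of `φ₉`**: `φ₉ g` is the even permutation acting on bisections as `g` acts on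
`ℙ¹(𝔽₉)` under Wilson's labelling. [this route] -/
theorem phi9_eq_of {g : SL(2, F9)} {σ : Equiv.Perm (Fin 6)} (hσ : σ ∈ alternatingGroup (Fin 6))
    (h : ∀ b : B, e (σ • b) = g • e b) : phi9 g = σ := by
  have key : Θ ⟨σ, hσ⟩ = (g : PSL(2, F9)) := by
    apply Matrix.ProjectiveSpecialLinearGroup.toPermHom_injective
    change ψP (θ ⟨σ, hσ⟩) = ψP (g : PSL(2, F9))
    rw [ψP_θ]
    refine Equiv.ext fun p => ?_
    obtain ⟨b, rfl⟩ := eqv.surjective p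
    rw [ρ_apply, eqv_apply]
    exact h b
  have h2 : Θ.symm (g : PSL(2, F9)) = ⟨σ, hσ⟩ := by
    rw [← key, MulEquiv.symm_apply_apply]
  show ((Θ.symm ((QuotientGroup.mk' (Subgroup.center SL(2, F9))) g) : alternatingGroup (Fin 6)) :
      Equiv.Perm (Fin 6)) = σ
  rw [QuotientGroup.mk'_apply, h2]

/-! ### The three generators under `φ₉` -/

/-- `(0 1 2)`. [folklore] -/
def σU : Equiv.Perm (Fin 6) := Equiv.swap 0 2 * Equiv.swap 0 1

/-- `(3 4 5)`. [folklore] -/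
def σV : Equiv.Perm (Fin 6) := Equiv.swap 3 5 * Equiv.swap 3 4

/-- `(0 3)(1 2)`. [folklore] -/
def σW : Equiv.Perm (Fin 6) := Equiv.swap 0 3 * Equiv.swap 1 2

/-- `(0 1 2) ∈ A₆`. [folklore] -/
theorem σU_mem : σU ∈ alternatingGroup (Fin 6) :=
  Equiv.Perm.mul_mem_alternatingGroup_of_isSwap ⟨0, 2, by decide, rfl⟩ ⟨0, 1, by decide, rfl⟩

/-- `(3 4 5) ∈ A₆`. [folklore] -/
theorem σV_mem : σV ∈ alternatingGroup (Fin 6) :=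
  Equiv.Perm.mul_mem_alternatingGroup_of_isSwap ⟨3, 5, by decide, rfl⟩ ⟨3, 4, by decide, rfl⟩

/-- `(0 3)(1 2) ∈ A₆`. [folklore] -/
theorem σW_mem : σW ∈ alternatingGroup (Fin 6) :=
  Equiv.Perm.mul_mem_alternatingGroup_of_isSwap ⟨0, 3, by decide, rfl⟩ ⟨1, 2, by decide, rfl⟩

/-- `(0 1 2)` acts on bisections as `u = (1 1; 0 1)`, i.e. `z ↦ z + 1` (ten checks). [cite:
Wilson2009, §3.3.5] -/
theorem e_σU_smul : ∀ b : B, e (σU • b) = gU • e b := by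
  decide +kernel

/-- `(3 4 5)` acts on bisections as `v = (1 i; 0 1)`, i.e. `z ↦ z + i`. [cite: Wilson2009, §3.3.5] -/
theorem e_σV_smul : ∀ b : B, e (σV • b) = gV • e b := by
  decide +kernel

/-- `(0 3)(1 2)` acts on bisections as `w = (0 1; -1 0)`, i.e. `z ↦ -1/z`. [folklore] -/
theorem e_σW_smul : ∀ b : B, e (σW • b) = gW • e b := by
  decide +kernel

/-- `φ₉ u = (0 1 2)`. [this route] -/
theorem phi9_gU : phi9 gU = σU := phi9_eq_of σU_mem e_σU_smul

/-- `φ₉ v = (3 4 5)`. [this route] -/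
theorem phi9_gV : phi9 gV = σV := phi9_eq_of σV_mem e_σV_smul

/-- `φ₉ w = (0 3)(1 2)`. [this route] -/
theorem phi9_gW : phi9 gW = σW := phi9_eq_of σW_mem e_σW_smul

/-! ### The intertwiner -/

/-- The intertwiner `P₉` (`det P₉ = 2i`), the solution of the linear system
`Heart(φ₉ x) P = P tw(x)`, `x = u, v, w` (one-dimensional solution space). [this route] -/
def P9 : Matrix (Fin 4) (Fin 4) F9 :=
  !![1, el 0 1, el 0 2, 0; 1, el 2 1, el 2 2, 1; 1, el 1 1, el 1 2, 1; 0, el 0 1, el 0 2, 1]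

/-- `det P₉ ≠ 0`. [this route] -/
theorem P9_det_ne_zero : P9.det ≠ 0 := by
  decide +kernel

/-- The intertwining identity at `u`. [this route] -/
theorem cert_U : heartMat F9 σU * P9 = P9 * tw (gU : Matrix (Fin 2) (Fin 2) F9) := by
  decide +kernel

/-- The intertwining identity at `v`. [this route] -/
theorem cert_V : heartMat F9 σV * P9 = P9 * tw (gV : Matrix (Fin 2) (Fin 2) F9) := by
  decide +kernel

/-- The intertwining identity at `w`. [this route] -/
theorem cert_W : heartMat F9 σW * P9 = P9 * tw (gW : Matrix (Fin 2) (Fin 2) F9) := by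
  decide +kernel

end Summit.Langlands.Langlands.Theorems.TrigonalHeartLimitHeartTwistedTensor
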